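import Mathlib.MeasureTheory.Function.JacobianOneDim
import Literature.Probability.RandomPlanarGeometry.EllipticKBasic
import HarnessLib

/-!
# Reduction of `∫ dx/√((a₁-x)(a₂-x)(x-a₃)(x-a₄))` over the middle gap `(a₃, a₂)` to the
# complete elliptic integral of the first kind (Gradshteyn–Ryzhik 3.147.4)

Topic `Literature/Analysis/SpecialFunctions`. For four real numbers `a₁ > a₂ > a₃ > a₄`,
Gradshteyn–Ryzhik 3.147.4 (with the upper limit `u = a₂`, where the incomplete integral `F`
becomes complete) reads

  `∫_{a₃}^{a₂} dx / √((a₁-x)(a₂-x)(x-a₃)(x-a₄)) = 2 K(q) / √((a₁-a₃)(a₂-a₄))`,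
  `q² = (a₂-a₃)(a₁-a₄) / ((a₁-a₃)(a₂-a₄))`  (modulus `q`, `0 < q² < 1`).

In the tree's PARAMETER convention (`Literature.Probability.RandomPlanarGeometry.ellipticK u =
∫₀¹ dt/√((1-t²)(1-u t²))`, `u = q²`) this file proves it, in the `ℝ≥0∞` form (no integrability
side condition; both endpoint singularities `(x-a₃)^{-1/2}`, `(a₂-x)^{-1/2}` are absorbed by the
change of variables) and in the Bochner form with integrability:

* `lintegral_inv_sqrt_quartic_eq_ellipticK` —
  `∫⁻ x in Ioo a₃ a₂, ofReal (1/√((a₁-x)(a₂-x)(x-a₃)(x-a₄))) = ofReal (2/√((a₁-a₃)(a₂-a₄)) · K(q²))`;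
* `integrableOn_inv_sqrt_quartic`, `integral_inv_sqrt_quartic_eq_ellipticK` — the same for `∫`.

Proof: the substitution `t² = (a₂-a₄)(x-a₃)/((a₂-a₃)(x-a₄))` of GR 3.147, i.e.
`x = φ(t) = a₄ + (a₂-a₄)(a₃-a₄)/((a₂-a₄) - (a₂-a₃)t²)`, maps `(0,1)` onto `(a₃,a₂)` with
`φ'(t) = 2(a₂-a₄)(a₂-a₃)(a₃-a₄)t/((a₂-a₄)-(a₂-a₃)t²)²` and
`(a₁-φ)(a₂-φ)(φ-a₃)(φ-a₄) = φ'(t)² (a₁-a₃)(a₂-a₄)(1-t²)(1-q²t²)/4` (a polynomial identity), whence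
`φ'(t)/√(quartic(φ(t))) = 2/(√((a₁-a₃)(a₂-a₄)) √((1-t²)(1-q²t²)))`; Mathlib's one-dimensional
change of variables `lintegral_image_eq_lintegral_abs_deriv_mul` does the rest.
Used by the closed form of the anisotropic square-lattice density of states
(`Literature/MathematicalPhysics/QuantumLattice/`, CERT-SREP (1.1) of the Kohn–Luttinger certificate
programme): after `c = cos x` the density-of-states integral `∫ dx 2/√(4b²-(μ+2a cos x)²)` is of this
form with roots `{1, -1, (2b-μ)/(2a), -(2b+μ)/(2a)}`.

## References
* [GradshteynRyzhik2015] I. S. Gradshteyn, I. M. Ryzhik, *Table of Integrals, Series, and Products*,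
  8th ed., 3.147.4 (and 3.147.2/.6 for the neighbouring gaps), 8.112.1 (definition of `K`).
* P. F. Byrd, M. D. Friedman, *Handbook of Elliptic Integrals*, 254.00 (the same reduction).
-/

noncomputable section

open Real _root_.MeasureTheory _root_.Set
open Literature.Probability.RandomPlanarGeometry

namespace Literature.Analysis.SpecialFunctions

namespace QuarticReduction

variable {a₁ a₂ a₃ a₄ : ℝ}

/-- The GR 3.147 substitution `x = φ(t) = a₄ + (a₂-a₄)(a₃-a₄)/((a₂-a₄) - (a₂-a₃)t²)`
(so that `t² = (a₂-a₄)(x-a₃)/((a₂-a₃)(x-a₄))`). [cite: GradshteynRyzhik2015, 3.147.4] -/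
def phi (a₂ a₃ a₄ t : ℝ) : ℝ := a₄ + (a₂ - a₄) * (a₃ - a₄) / ((a₂ - a₄) - (a₂ - a₃) * t ^ 2)

/-- Its derivative `φ'(t) = 2(a₂-a₄)(a₂-a₃)(a₃-a₄) t / ((a₂-a₄) - (a₂-a₃)t²)²`. [cite: GradshteynRyzhik2015, 3.147.4] -/
def dphi (a₂ a₃ a₄ t : ℝ) : ℝ :=
  2 * (a₂ - a₄) * (a₂ - a₃) * (a₃ - a₄) * t / ((a₂ - a₄) - (a₂ - a₃) * t ^ 2) ^ 2

/-- The parameter `q² = (a₂-a₃)(a₁-a₄)/((a₁-a₃)(a₂-a₄))` of GR 3.147. [cite: GradshteynRyzhik2015, 3.147] -/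
def modulusSq (a₁ a₂ a₃ a₄ : ℝ) : ℝ := (a₂ - a₃) * (a₁ - a₄) / ((a₁ - a₃) * (a₂ - a₄))

/-- `0 < q²` (the modulus of GR 3.147 is real). [cite: GradshteynRyzhik2015, 3.147] -/
theorem modulusSq_pos (h₁₂ : a₂ < a₁) (h₂₃ : a₃ < a₂) (h₃₄ : a₄ < a₃) : 0 < modulusSq a₁ a₂ a₃ a₄ := by
  unfold modulusSq
  apply div_pos <;> apply _root_.mul_pos <;> linarith

/-- `q² < 1` (equivalently `(a₁-a₂)(a₃-a₄) > 0`; the modulus of GR 3.147 is `< 1`). [cite: GradshteynRyzhik2015, 3.147] -/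
theorem modulusSq_lt_one (h₁₂ : a₂ < a₁) (h₂₃ : a₃ < a₂) (h₃₄ : a₄ < a₃) : modulusSq a₁ a₂ a₃ a₄ < 1 := by
  unfold modulusSq
  have hden : 0 < (a₁ - a₃) * (a₂ - a₄) := _root_.mul_pos (by linarith) (by linarith)
  rw [div_lt_one hden]
  nlinarith [_root_.mul_pos (sub_pos.2 h₁₂) (sub_pos.2 h₃₄)]

/-- The denominator `(a₂-a₄) - (a₂-a₃)t²` is positive for `t² ≤ 1`. [folklore] -/
private theorem den_pos (h₂₃ : a₃ < a₂) (h₃₄ : a₄ < a₃) {t : ℝ} (ht : t ^ 2 ≤ 1) :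
    0 < (a₂ - a₄) - (a₂ - a₃) * t ^ 2 := by
  nlinarith [sub_pos.2 h₂₃, sub_pos.2 h₃₄]

/-- `φ(t) - a₃ = (a₂-a₃)(a₃-a₄)t²/den`. [folklore] -/
private theorem phi_sub_a₃ (h₂₃ : a₃ < a₂) (h₃₄ : a₄ < a₃) {t : ℝ} (ht : t ^ 2 ≤ 1) :
    phi a₂ a₃ a₄ t - a₃ = (a₂ - a₃) * (a₃ - a₄) * t ^ 2 / ((a₂ - a₄) - (a₂ - a₃) * t ^ 2) := by
  have hd := (den_pos h₂₃ h₃₄ ht).ne'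
  unfold phi; field_simp; ring

/-- `a₂ - φ(t) = (a₂-a₄)(a₂-a₃)(1-t²)/den`. [folklore] -/
private theorem a₂_sub_phi (h₂₃ : a₃ < a₂) (h₃₄ : a₄ < a₃) {t : ℝ} (ht : t ^ 2 ≤ 1) :
    a₂ - phi a₂ a₃ a₄ t = (a₂ - a₄) * (a₂ - a₃) * (1 - t ^ 2) / ((a₂ - a₄) - (a₂ - a₃) * t ^ 2) := by
  have hd := (den_pos h₂₃ h₃₄ ht).ne'
  unfold phi; field_simp; ring

/-- `a₁ - φ(t) = (a₂-a₄)(a₁-a₃)(1-q²t²)/den`. [folklore] -/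
private theorem a₁_sub_phi (h₁₂ : a₂ < a₁) (h₂₃ : a₃ < a₂) (h₃₄ : a₄ < a₃) {t : ℝ} (ht : t ^ 2 ≤ 1) :
    a₁ - phi a₂ a₃ a₄ t =
      (a₂ - a₄) * (a₁ - a₃) * (1 - modulusSq a₁ a₂ a₃ a₄ * t ^ 2) / ((a₂ - a₄) - (a₂ - a₃) * t ^ 2) := by
  have hd := (den_pos h₂₃ h₃₄ ht).ne'
  have h13 : (a₁ - a₃) ≠ 0 := by linarith
  have h24 : (a₂ - a₄) ≠ 0 := by linarith
  unfold phi modulusSq; field_simp; ring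

/-- `φ(t) - a₄ = (a₂-a₄)(a₃-a₄)/den`. [folklore] -/
private theorem phi_sub_a₄ (t : ℝ) :
    phi a₂ a₃ a₄ t - a₄ = (a₂ - a₄) * (a₃ - a₄) / ((a₂ - a₄) - (a₂ - a₃) * t ^ 2) := by
  unfold phi; ring

/-- `φ` maps `(0,1)` into `(a₃, a₂)`. [folklore] -/
private theorem phi_mem_Ioo (h₂₃ : a₃ < a₂) (h₃₄ : a₄ < a₃) {t : ℝ} (ht : t ∈ Ioo (0 : ℝ) 1) :
    phi a₂ a₃ a₄ t ∈ Ioo a₃ a₂ := by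
  have ht2 : t ^ 2 ≤ 1 := by nlinarith [ht.1, ht.2]
  have hd := den_pos h₂₃ h₃₄ ht2
  constructor
  · have := phi_sub_a₃ h₂₃ h₃₄ ht2
    have hnum : 0 < (a₂ - a₃) * (a₃ - a₄) * t ^ 2 :=
      _root_.mul_pos (_root_.mul_pos (by linarith) (by linarith)) (by nlinarith [ht.1])
    linarith [div_pos hnum hd]
  · have := a₂_sub_phi h₂₃ h₃₄ ht2
    have hnum : 0 < (a₂ - a₄) * (a₂ - a₃) * (1 - t ^ 2) :=
      _root_.mul_pos (_root_.mul_pos (by linarith) (by linarith)) (by nlinarith [ht.1, ht.2])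
    linarith [div_pos hnum hd]

/-- `φ'(t) > 0` on `(0,1)`. [folklore] -/
private theorem dphi_pos (h₂₃ : a₃ < a₂) (h₃₄ : a₄ < a₃) {t : ℝ} (ht : t ∈ Ioo (0 : ℝ) 1) : 0 < dphi a₂ a₃ a₄ t := by
  have ht2 : t ^ 2 ≤ 1 := by nlinarith [ht.1, ht.2]
  unfold dphi
  apply div_pos
  · have : 0 < (a₂ - a₄) * (a₂ - a₃) * (a₃ - a₄) :=
      _root_.mul_pos (_root_.mul_pos (by linarith) (by linarith)) (by linarith)
    nlinarith [ht.1]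
  · exact pow_pos (den_pos h₂₃ h₃₄ ht2) 2

/-- `φ` has derivative `φ'` at every `t` with `t² ≤ 1`. [folklore] -/
private theorem hasDerivAt_phi (h₂₃ : a₃ < a₂) (h₃₄ : a₄ < a₃) {t : ℝ} (ht : t ^ 2 ≤ 1) :
    HasDerivAt (phi a₂ a₃ a₄) (dphi a₂ a₃ a₄ t) t := by
  have hd := (den_pos h₂₃ h₃₄ ht).ne'
  have hden : HasDerivAt (fun t : ℝ => (a₂ - a₄) - (a₂ - a₃) * t ^ 2) (-((a₂ - a₃) * (2 * t))) t := by
    have := ((hasDerivAt_pow 2 t).const_mul (a₂ - a₃)).const_sub (a₂ - a₄)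
    simpa using this
  have h : HasDerivAt (phi a₂ a₃ a₄)
      ((0 * ((a₂ - a₄) - (a₂ - a₃) * t ^ 2) - (a₂ - a₄) * (a₃ - a₄) * -((a₂ - a₃) * (2 * t))) /
        ((a₂ - a₄) - (a₂ - a₃) * t ^ 2) ^ 2) t :=
    ((hasDerivAt_const t ((a₂ - a₄) * (a₃ - a₄))).div hden hd).const_add a₄
  convert h using 1
  unfold dphi; field_simp; ring

/-- `φ` is injective on `(0,1)` (it is strictly increasing there). [folklore] -/
private theorem injOn_phi (h₂₃ : a₃ < a₂) (h₃₄ : a₄ < a₃) : InjOn (phi a₂ a₃ a₄) (Ioo (0 : ℝ) 1) := by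
  intro s hs t ht hst
  have hs2 : s ^ 2 ≤ 1 := by nlinarith [hs.1, hs.2]
  have ht2 : t ^ 2 ≤ 1 := by nlinarith [ht.1, ht.2]
  have hds := (den_pos h₂₃ h₃₄ hs2).ne'
  have hdt := (den_pos h₂₃ h₃₄ ht2).ne'
  have hc : (a₂ - a₄) * (a₃ - a₄) ≠ 0 := (_root_.mul_pos (by linarith) (by linarith)).ne'
  unfold phi at hst
  have h1 : (a₂ - a₄) * (a₃ - a₄) / ((a₂ - a₄) - (a₂ - a₃) * s ^ 2) =
      (a₂ - a₄) * (a₃ - a₄) / ((a₂ - a₄) - (a₂ - a₃) * t ^ 2) := by linarith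
  rw [div_eq_div_iff hds hdt] at h1
  have h2 : (a₂ - a₃) * s ^ 2 = (a₂ - a₃) * t ^ 2 := by
    have := mul_left_cancel₀ hc h1
    linarith
  have h3 : s ^ 2 = t ^ 2 := mul_left_cancel₀ (by linarith : (a₂ - a₃) ≠ 0) h2
  nlinarith [hs.1, ht.1]

/-- The image `φ((0,1)) = (a₃, a₂)` (explicit inverse `t = √((a₂-a₄)(x-a₃)/((a₂-a₃)(x-a₄)))`). [folklore] -/
private theorem image_phi (h₂₃ : a₃ < a₂) (h₃₄ : a₄ < a₃) : phi a₂ a₃ a₄ '' Ioo (0 : ℝ) 1 = Ioo a₃ a₂ := by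
  apply Subset.antisymm
  · rintro x ⟨t, ht, rfl⟩; exact phi_mem_Ioo h₂₃ h₃₄ ht
  · intro x hx
    set r : ℝ := (a₂ - a₄) * (x - a₃) / ((a₂ - a₃) * (x - a₄)) with hr
    have hxa₄ : 0 < x - a₄ := by linarith [hx.1]
    have hden : 0 < (a₂ - a₃) * (x - a₄) := _root_.mul_pos (by linarith) hxa₄
    have hr0 : 0 < r := div_pos (_root_.mul_pos (by linarith) (by linarith [hx.1])) hden
    have hr1 : r < 1 := by
      rw [hr, div_lt_one hden]; nlinarith [hx.2, sub_pos.2 h₃₄, sub_pos.2 h₂₃]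
    refine ⟨Real.sqrt r, ⟨Real.sqrt_pos.2 hr0, (Real.sqrt_lt' one_pos).2 (by simpa using hr1)⟩, ?_⟩
    have hsq : Real.sqrt r ^ 2 = r := Real.sq_sqrt hr0.le
    have h23 : a₂ - a₃ ≠ 0 := by linarith
    have hx4 : x - a₄ ≠ 0 := hxa₄.ne'
    have hd2 : (a₂ - a₄) - (a₂ - a₃) * r = (a₂ - a₄) * (a₃ - a₄) / (x - a₄) := by
      rw [hr]; field_simp; ring
    have h24 : (a₂ - a₄) * (a₃ - a₄) ≠ 0 := (_root_.mul_pos (by linarith) (by linarith)).ne'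
    have key : phi a₂ a₃ a₄ (Real.sqrt r) - a₄ = x - a₄ := by
      rw [phi_sub_a₄, hsq, hd2, div_div_eq_mul_div, mul_div_cancel_left₀ _ h24]
    linarith

/-! ### The Jacobian identity and the reduction -/

/-- **The polynomial identity behind GR 3.147.4**:
`(a₁-φ)(a₂-φ)(φ-a₃)(φ-a₄) = φ'(t)²·(a₁-a₃)(a₂-a₄)·(1-t²)(1-q²t²)/4`. [cite: GradshteynRyzhik2015, 3.147.4] -/
theorem quartic_phi_eq (h₁₂ : a₂ < a₁) (h₂₃ : a₃ < a₂) (h₃₄ : a₄ < a₃) {t : ℝ} (ht : t ^ 2 ≤ 1) :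
    (a₁ - phi a₂ a₃ a₄ t) * (a₂ - phi a₂ a₃ a₄ t) * (phi a₂ a₃ a₄ t - a₃) * (phi a₂ a₃ a₄ t - a₄) =
      dphi a₂ a₃ a₄ t ^ 2 * ((a₁ - a₃) * (a₂ - a₄)) *
        ((1 - t ^ 2) * (1 - modulusSq a₁ a₂ a₃ a₄ * t ^ 2)) / 4 := by
  have hd := (den_pos h₂₃ h₃₄ ht).ne'
  rw [a₁_sub_phi h₁₂ h₂₃ h₃₄ ht, a₂_sub_phi h₂₃ h₃₄ ht, phi_sub_a₃ h₂₃ h₃₄ ht, phi_sub_a₄]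
  unfold dphi
  field_simp
  ring

/-- **The Jacobian identity**: on `(0,1)`,
`|φ'(t)| / √((a₁-φ)(a₂-φ)(φ-a₃)(φ-a₄)) = (2/√((a₁-a₃)(a₂-a₄))) · 1/√((1-t²)(1-q²t²))`.
[cite: GradshteynRyzhik2015, 3.147.4] -/
theorem abs_dphi_mul_inv_sqrt_quartic (h₁₂ : a₂ < a₁) (h₂₃ : a₃ < a₂) (h₃₄ : a₄ < a₃) {t : ℝ}
    (ht : t ∈ Ioo (0 : ℝ) 1) :
    |dphi a₂ a₃ a₄ t| *
        (1 / Real.sqrt ((a₁ - phi a₂ a₃ a₄ t) * (a₂ - phi a₂ a₃ a₄ t) * (phi a₂ a₃ a₄ t - a₃) *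
          (phi a₂ a₃ a₄ t - a₄))) =
      2 / Real.sqrt ((a₁ - a₃) * (a₂ - a₄)) * ellIntegrand (modulusSq a₁ a₂ a₃ a₄) t := by
  have ht2 : t ^ 2 ≤ 1 := by nlinarith [ht.1, ht.2]
  have ht2' : t ^ 2 < 1 := by nlinarith [ht.1, ht.2]
  have hφ' := dphi_pos h₂₃ h₃₄ ht
  have hC : 0 < (a₁ - a₃) * (a₂ - a₄) := _root_.mul_pos (by linarith) (by linarith)
  have hq1 := modulusSq_lt_one h₁₂ h₂₃ h₃₄
  have hq0 := modulusSq_pos h₁₂ h₂₃ h₃₄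
  have hE : 0 < (1 - t ^ 2) * (1 - modulusSq a₁ a₂ a₃ a₄ * t ^ 2) := by
    apply _root_.mul_pos (by linarith)
    nlinarith
  set C := (a₁ - a₃) * (a₂ - a₄) with hCdef
  set E := (1 - t ^ 2) * (1 - modulusSq a₁ a₂ a₃ a₄ * t ^ 2) with hEdef
  have hquart : (a₁ - phi a₂ a₃ a₄ t) * (a₂ - phi a₂ a₃ a₄ t) * (phi a₂ a₃ a₄ t - a₃) * (phi a₂ a₃ a₄ t - a₄) =
      (dphi a₂ a₃ a₄ t * Real.sqrt C * Real.sqrt E / 2) ^ 2 := by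
    rw [quartic_phi_eq h₁₂ h₂₃ h₃₄ ht2, ← hCdef, ← hEdef]
    rw [show (dphi a₂ a₃ a₄ t * Real.sqrt C * Real.sqrt E / 2) ^ 2 =
        dphi a₂ a₃ a₄ t ^ 2 * (Real.sqrt C) ^ 2 * (Real.sqrt E) ^ 2 / 4 by ring,
      Real.sq_sqrt hC.le, Real.sq_sqrt hE.le]
  have hpos : 0 < dphi a₂ a₃ a₄ t * Real.sqrt C * Real.sqrt E / 2 := by
    have := Real.sqrt_pos.2 hC; have := Real.sqrt_pos.2 hE; positivity
  rw [hquart, Real.sqrt_sq hpos.le, abs_of_pos hφ']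
  unfold ellIntegrand
  rw [← hEdef]
  have hsC := (Real.sqrt_pos.2 hC).ne'
  have hsE := (Real.sqrt_pos.2 hE).ne'
  field_simp

/-- **Gradshteyn–Ryzhik 3.147.4 (complete case), `ℝ≥0∞` form**: for `a₁ > a₂ > a₃ > a₄`,
`∫⁻_{x ∈ (a₃,a₂)} 1/√((a₁-x)(a₂-x)(x-a₃)(x-a₄)) dx = 2 K(q²)/√((a₁-a₃)(a₂-a₄))`,
`q² = (a₂-a₃)(a₁-a₄)/((a₁-a₃)(a₂-a₄))`, with `K = ellipticK` (parameter convention).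
[cite: GradshteynRyzhik2015, 3.147.4] -/
theorem lintegral_inv_sqrt_quartic_eq_ellipticK (h₁₂ : a₂ < a₁) (h₂₃ : a₃ < a₂) (h₃₄ : a₄ < a₃) :
    ∫⁻ x in Ioo a₃ a₂, ENNReal.ofReal (1 / Real.sqrt ((a₁ - x) * (a₂ - x) * (x - a₃) * (x - a₄))) =
      ENNReal.ofReal (2 / Real.sqrt ((a₁ - a₃) * (a₂ - a₄)) * ellipticK (modulusSq a₁ a₂ a₃ a₄)) := by
  have hq1 := modulusSq_lt_one h₁₂ h₂₃ h₃₄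
  have hC : 0 < (a₁ - a₃) * (a₂ - a₄) := _root_.mul_pos (by linarith) (by linarith)
  have hderiv : ∀ t ∈ Ioo (0 : ℝ) 1,
      HasDerivWithinAt (phi a₂ a₃ a₄) (dphi a₂ a₃ a₄ t) (Ioo (0 : ℝ) 1) t := fun t ht =>
    (hasDerivAt_phi h₂₃ h₃₄ (by nlinarith [ht.1, ht.2])).hasDerivWithinAt
  rw [← image_phi h₂₃ h₃₄,
    lintegral_image_eq_lintegral_abs_deriv_mul measurableSet_Ioo hderiv (injOn_phi h₂₃ h₃₄)]
  have hpt : ∀ t ∈ Ioo (0 : ℝ) 1,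
      ENNReal.ofReal |dphi a₂ a₃ a₄ t| *
          ENNReal.ofReal (1 / Real.sqrt ((a₁ - phi a₂ a₃ a₄ t) * (a₂ - phi a₂ a₃ a₄ t) *
            (phi a₂ a₃ a₄ t - a₃) * (phi a₂ a₃ a₄ t - a₄))) =
        ENNReal.ofReal (2 / Real.sqrt ((a₁ - a₃) * (a₂ - a₄))) *
          ENNReal.ofReal (ellIntegrand (modulusSq a₁ a₂ a₃ a₄) t) := by
    intro t ht
    rw [← ENNReal.ofReal_mul (abs_nonneg _), abs_dphi_mul_inv_sqrt_quartic h₁₂ h₂₃ h₃₄ ht,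
      ENNReal.ofReal_mul (by positivity)]
  rw [setLIntegral_congr_fun measurableSet_Ioo hpt, lintegral_const_mul' _ _ ENNReal.ofReal_ne_top]
  have hint : IntegrableOn (ellIntegrand (modulusSq a₁ a₂ a₃ a₄)) (Ioo (0 : ℝ) 1) :=
    ((intervalIntegrable_ellIntegrand_of_lt_one hq1).1).mono_set Ioo_subset_Ioc_self
  rw [← ofReal_integral_eq_lintegral_ofReal hint
      (Filter.Eventually.of_forall fun t => ellIntegrand_nonneg _ t),
    ← ENNReal.ofReal_mul (by positivity)]
  congr 1
  rw [ellipticK_eq, intervalIntegral.integral_of_le zero_le_one, integral_Ioc_eq_integral_Ioo]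

/-- Integrability of `1/√((a₁-x)(a₂-x)(x-a₃)(x-a₄))` on the middle gap `(a₃, a₂)`.
[cite: GradshteynRyzhik2015, 3.147.4] -/
theorem integrableOn_inv_sqrt_quartic (h₁₂ : a₂ < a₁) (h₂₃ : a₃ < a₂) (h₃₄ : a₄ < a₃) :
    IntegrableOn (fun x : ℝ => 1 / Real.sqrt ((a₁ - x) * (a₂ - x) * (x - a₃) * (x - a₄))) (Ioo a₃ a₂) := by
  have hmeas : Measurable fun x : ℝ => 1 / Real.sqrt ((a₁ - x) * (a₂ - x) * (x - a₃) * (x - a₄)) := by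
    fun_prop
  refine ⟨hmeas.aestronglyMeasurable, ?_⟩
  rw [hasFiniteIntegral_iff_ofReal (Filter.Eventually.of_forall fun x => by positivity)]
  rw [lintegral_inv_sqrt_quartic_eq_ellipticK h₁₂ h₂₃ h₃₄]
  exact ENNReal.ofReal_lt_top

/-- **Gradshteyn–Ryzhik 3.147.4 (complete case), Bochner form**: for `a₁ > a₂ > a₃ > a₄`,
`∫_{x ∈ (a₃,a₂)} dx/√((a₁-x)(a₂-x)(x-a₃)(x-a₄)) = 2 K(q²)/√((a₁-a₃)(a₂-a₄))`.
[cite: GradshteynRyzhik2015, 3.147.4] -/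
theorem integral_inv_sqrt_quartic_eq_ellipticK (h₁₂ : a₂ < a₁) (h₂₃ : a₃ < a₂) (h₃₄ : a₄ < a₃) :
    ∫ x in Ioo a₃ a₂, 1 / Real.sqrt ((a₁ - x) * (a₂ - x) * (x - a₃) * (x - a₄)) =
      2 / Real.sqrt ((a₁ - a₃) * (a₂ - a₄)) * ellipticK (modulusSq a₁ a₂ a₃ a₄) := by
  have h := lintegral_inv_sqrt_quartic_eq_ellipticK h₁₂ h₂₃ h₃₄
  rw [← ofReal_integral_eq_lintegral_ofReal (integrableOn_inv_sqrt_quartic h₁₂ h₂₃ h₃₄)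
    (Filter.Eventually.of_forall fun x => by positivity)] at h
  exact (ENNReal.ofReal_eq_ofReal_iff (setIntegral_nonneg measurableSet_Ioo fun x _ => by positivity)
    (mul_nonneg (by positivity) (ellipticK_nonneg _))).1 h

end QuarticReduction

end Literature.Analysis.SpecialFunctions
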